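import Mathlib
import Summits.AtomisticToContinuum.BoseEinsteinCondensation.Theorems.BlockLatticeFSumEngineBond

/-!
# Super-block Cauchy–Schwarz on the block torus `(Fin K)³` (route `BlockLatticeFSum`; decomp-a2c lens-6 g22)

Def-free port (index group `Fin 3 → Fin K`, `[NeZero K]`) of the engine's corner algebra:
corner offsets `τ ∈ {0,1}³ ↦ (i ↦ (τ i) • 1)`, axis steps `Pi.single j 1`,
`sum_cube_split`, `superblock_cs` (parallelogram law + Cauchy–Schwarz in one super-block),
`sum_corners` (translation count), and the assembled POINTWISE CORNER INEQUALITY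
`Σ_j Σ_B ‖w_B − w_(B+e_j)‖²/2 + (3/4)·Σ_c ‖Σ_τ w_(c+τ)‖²/8 ≤ 6·Σ_B ‖w_B‖²` (`corner_inequality`).
Mathlib only; no definitions; no `sorry`.
-/

namespace Summit.AtomisticToContinuum.BoseEinsteinCondensation.Theses.BlockLatticeFSum.Superblock

open scoped BigOperators

variable {K : ℕ} [NeZero K]
variable {E : Type*} [NormedAddCommGroup E] [InnerProductSpace ℂ E]

/-- Updating one coordinate of `τ` from `0` to `1` adds `Pi.single j 1` to the scaled corner vector. [folklore] -/
theorem iota_update_one (τ : Fin 3 → Fin 2) (j : Fin 3) (hτ : τ j = 0) :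
    (fun i : Fin 3 => (((Function.update τ j 1 : Fin 3 → Fin 2) i : ℕ) • (1 : Fin K)))
      = (fun i : Fin 3 => ((τ i : ℕ) • (1 : Fin K))) + (Pi.single j (1 : Fin K) : Fin 3 → Fin K) := by
  funext i
  by_cases h : i = j
  · subst h
    simp [hτ]
  · simp [Function.update_of_ne h, Pi.single_eq_of_ne h]

/-- Splitting the 8 blocks of a super-block into the 4 `j`-bonds. -/
theorem sum_cube_split {M : Type*} [AddCommMonoid M] (f : (Fin 3 → Fin K) → M)
    (c : Fin 3 → Fin K) (j : Fin 3) :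
    ∑ τ : Fin 3 → Fin 2, f (c + fun i : Fin 3 => ((τ i : ℕ) • (1 : Fin K)))
      = ∑ τ ∈ Finset.univ.filter (fun τ : Fin 3 → Fin 2 => τ j = 0),
          (f (c + fun i : Fin 3 => ((τ i : ℕ) • (1 : Fin K)))
            + f (c + (fun i : Fin 3 => ((τ i : ℕ) • (1 : Fin K))) + (Pi.single j (1 : Fin K) : Fin 3 → Fin K))) := by
  classical
  rw [Finset.sum_add_distrib,
    ← Finset.sum_filter_add_sum_filter_not Finset.univ (fun τ : Fin 3 → Fin 2 => τ j = 0)]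
  congr 1
  symm
  refine Finset.sum_nbij' (fun τ => Function.update τ j 1) (fun τ => Function.update τ j 0)
    ?_ ?_ ?_ ?_ ?_
  · intro τ hτ
    simp
  · intro τ hτ
    simp
  · intro τ hτ
    rw [Finset.mem_filter] at hτ
    funext i
    by_cases h : i = j
    · subst h; simp [hτ.2]
    · simp [Function.update_of_ne h]
  · intro τ hτ
    rw [Finset.mem_filter] at hτ
    have h1 : τ j = 1 := Fin.eq_one_of_ne_zero _ hτ.2
    funext i
    by_cases h : i = j
    · subst h; simp [h1]
    · simp [Function.update_of_ne h]
  · intro τ hτ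
    rw [Finset.mem_filter] at hτ
    rw [iota_update_one τ j hτ.2, add_assoc]

/-- **Cauchy–Schwarz in one super-block, one axis.** -/
theorem superblock_cs (wv : (Fin 3 → Fin K) → E) (c : Fin 3 → Fin K) (j : Fin 3) :
    ∑ τ ∈ Finset.univ.filter (fun τ : Fin 3 → Fin 2 => τ j = 0),
        ‖wv (c + fun i : Fin 3 => ((τ i : ℕ) • (1 : Fin K)))
          - wv (c + (fun i : Fin 3 => ((τ i : ℕ) • (1 : Fin K))) + (Pi.single j (1 : Fin K) : Fin 3 → Fin K))‖ ^ 2 / 2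
      ≤ ∑ τ : Fin 3 → Fin 2, ‖wv (c + fun i : Fin 3 => ((τ i : ℕ) • (1 : Fin K)))‖ ^ 2
          - ‖∑ τ : Fin 3 → Fin 2, wv (c + fun i : Fin 3 => ((τ i : ℕ) • (1 : Fin K)))‖ ^ 2 / 8 := by
  classical
  set T := Finset.univ.filter (fun τ : Fin 3 → Fin 2 => τ j = 0) with hT
  have hpar : ∀ τ : Fin 3 → Fin 2,
      ‖wv (c + fun i : Fin 3 => ((τ i : ℕ) • (1 : Fin K)))
          - wv (c + (fun i : Fin 3 => ((τ i : ℕ) • (1 : Fin K))) + (Pi.single j (1 : Fin K) : Fin 3 → Fin K))‖ ^ 2 / 2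
      = (‖wv (c + fun i : Fin 3 => ((τ i : ℕ) • (1 : Fin K)))‖ ^ 2
          + ‖wv (c + (fun i : Fin 3 => ((τ i : ℕ) • (1 : Fin K))) + (Pi.single j (1 : Fin K) : Fin 3 → Fin K))‖ ^ 2)
          - ‖wv (c + fun i : Fin 3 => ((τ i : ℕ) • (1 : Fin K)))
              + wv (c + (fun i : Fin 3 => ((τ i : ℕ) • (1 : Fin K))) + (Pi.single j (1 : Fin K) : Fin 3 → Fin K))‖ ^ 2 / 2 := by
    intro τ
    have := parallelogram_law_with_norm ℂ (wv (c + fun i : Fin 3 => ((τ i : ℕ) • (1 : Fin K))))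
      (wv (c + (fun i : Fin 3 => ((τ i : ℕ) • (1 : Fin K))) + (Pi.single j (1 : Fin K) : Fin 3 → Fin K)))
    linarith
  simp_rw [hpar]
  rw [Finset.sum_sub_distrib, ← sum_cube_split (fun B => ‖wv B‖ ^ 2) c j]
  have hsum : ∑ τ : Fin 3 → Fin 2, wv (c + fun i : Fin 3 => ((τ i : ℕ) • (1 : Fin K)))
      = ∑ τ ∈ T, (wv (c + fun i : Fin 3 => ((τ i : ℕ) • (1 : Fin K)))
          + wv (c + (fun i : Fin 3 => ((τ i : ℕ) • (1 : Fin K))) + (Pi.single j (1 : Fin K) : Fin 3 → Fin K))) :=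
    sum_cube_split wv c j
  have hcard : T.card ≤ 4 := (Summit.AtomisticToContinuum.BoseEinsteinCondensation.Theses.BlockLatticeFSum.Engine.card_filter_cube (j := j)).le
  have hcs : ‖∑ τ : Fin 3 → Fin 2, wv (c + fun i : Fin 3 => ((τ i : ℕ) • (1 : Fin K)))‖ ^ 2
      ≤ 4 * ∑ τ ∈ T, ‖wv (c + fun i : Fin 3 => ((τ i : ℕ) • (1 : Fin K)))
          + wv (c + (fun i : Fin 3 => ((τ i : ℕ) • (1 : Fin K))) + (Pi.single j (1 : Fin K) : Fin 3 → Fin K))‖ ^ 2 := by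
    rw [hsum]
    calc ‖∑ τ ∈ T, (wv (c + fun i : Fin 3 => ((τ i : ℕ) • (1 : Fin K)))
            + wv (c + (fun i : Fin 3 => ((τ i : ℕ) • (1 : Fin K))) + (Pi.single j (1 : Fin K) : Fin 3 → Fin K)))‖ ^ 2
        ≤ (∑ τ ∈ T, ‖wv (c + fun i : Fin 3 => ((τ i : ℕ) • (1 : Fin K)))
            + wv (c + (fun i : Fin 3 => ((τ i : ℕ) • (1 : Fin K))) + (Pi.single j (1 : Fin K) : Fin 3 → Fin K))‖) ^ 2 := by
          gcongr
          exact norm_sum_le _ _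
      _ ≤ T.card * ∑ τ ∈ T, ‖wv (c + fun i : Fin 3 => ((τ i : ℕ) • (1 : Fin K)))
            + wv (c + (fun i : Fin 3 => ((τ i : ℕ) • (1 : Fin K))) + (Pi.single j (1 : Fin K) : Fin 3 → Fin K))‖ ^ 2 :=
          sq_sum_le_card_mul_sum_sq
      _ ≤ 4 * ∑ τ ∈ T, ‖wv (c + fun i : Fin 3 => ((τ i : ℕ) • (1 : Fin K)))
            + wv (c + (fun i : Fin 3 => ((τ i : ℕ) • (1 : Fin K))) + (Pi.single j (1 : Fin K) : Fin 3 → Fin K))‖ ^ 2 :=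
          mul_le_mul_of_nonneg_right (by exact_mod_cast hcard)
            (Finset.sum_nonneg fun _ _ => sq_nonneg _)
  have : ‖∑ τ : Fin 3 → Fin 2, wv (c + fun i : Fin 3 => ((τ i : ℕ) • (1 : Fin K)))‖ ^ 2 / 8
      ≤ ∑ τ ∈ T, ‖wv (c + fun i : Fin 3 => ((τ i : ℕ) • (1 : Fin K)))
          + wv (c + (fun i : Fin 3 => ((τ i : ℕ) • (1 : Fin K))) + (Pi.single j (1 : Fin K) : Fin 3 → Fin K))‖ ^ 2 / 2 := by
    rw [← Finset.sum_div]
    linarith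
  linarith

/-- Translation count: summing a block function over all corners and a set `T` of offsets counts it
`|T|` times. -/
theorem sum_corners (f : (Fin 3 → Fin K) → ℝ) (T : Finset (Fin 3 → Fin 2)) :
    ∑ c : Fin 3 → Fin K, ∑ τ ∈ T, f (c + fun i : Fin 3 => ((τ i : ℕ) • (1 : Fin K)))
      = T.card * ∑ B : Fin 3 → Fin K, f B := by
  classical
  rw [Finset.sum_comm]
  have : ∀ τ ∈ T, ∑ c : Fin 3 → Fin K, f (c + fun i : Fin 3 => ((τ i : ℕ) • (1 : Fin K)))
      = ∑ B : Fin 3 → Fin K, f B := by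
    intro τ _
    exact Fintype.sum_equiv (Equiv.addRight (fun i : Fin 3 => ((τ i : ℕ) • (1 : Fin K)))) _ _ fun c => rfl
  rw [Finset.sum_congr rfl this, Finset.sum_const, nsmul_eq_mul]

omit [NeZero K] in
/-- `#({0,1}³) = 8`. -/
theorem card_cube : Fintype.card (Fin 3 → Fin 2) = 8 := by simp

/-- **POINTWISE CORNER INEQUALITY.** For any block vector `w` (e.g. `w_B = a(u_B)Ψ(Y)`):
`Σ_j Σ_B ‖w_B − w_(B+e_j)‖²/2 + (3/4)·Σ_c ‖Σ_τ w_(c+τ)‖²/8 ≤ 6·Σ_B ‖w_B‖²`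
(each bond is an interior `j`-bond of exactly 4 super-blocks; each block lies in exactly 8). -/
theorem corner_inequality (wv : (Fin 3 → Fin K) → E) :
    ∑ j : Fin 3, ∑ B : Fin 3 → Fin K, ‖wv B - wv (B + (Pi.single j (1 : Fin K) : Fin 3 → Fin K))‖ ^ 2 / 2
      + 3 / 4 * ∑ c : Fin 3 → Fin K,
          ‖∑ τ : Fin 3 → Fin 2, wv (c + fun i : Fin 3 => ((τ i : ℕ) • (1 : Fin K)))‖ ^ 2 / 8
      ≤ 6 * ∑ B : Fin 3 → Fin K, ‖wv B‖ ^ 2 := by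
  classical
  have h1 : ∀ j : Fin 3, ∑ B : Fin 3 → Fin K, ‖wv B - wv (B + (Pi.single j (1 : Fin K) : Fin 3 → Fin K))‖ ^ 2 / 2
      = 1 / 4 * ∑ c : Fin 3 → Fin K, ∑ τ ∈ Finset.univ.filter (fun τ : Fin 3 → Fin 2 => τ j = 0),
          ‖wv (c + fun i : Fin 3 => ((τ i : ℕ) • (1 : Fin K)))
            - wv (c + (fun i : Fin 3 => ((τ i : ℕ) • (1 : Fin K))) + (Pi.single j (1 : Fin K) : Fin 3 → Fin K))‖ ^ 2 / 2 := by
    intro j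
    rw [sum_corners (fun B => ‖wv B - wv (B + (Pi.single j (1 : Fin K) : Fin 3 → Fin K))‖ ^ 2 / 2)
      (Finset.univ.filter (fun τ : Fin 3 → Fin 2 => τ j = 0)), Summit.AtomisticToContinuum.BoseEinsteinCondensation.Theses.BlockLatticeFSum.Engine.card_filter_cube]
    ring
  have h3 : ∑ c : Fin 3 → Fin K, ∑ τ : Fin 3 → Fin 2, ‖wv (c + fun i : Fin 3 => ((τ i : ℕ) • (1 : Fin K)))‖ ^ 2
      = 8 * ∑ B : Fin 3 → Fin K, ‖wv B‖ ^ 2 := by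
    rw [sum_corners (fun B => ‖wv B‖ ^ 2) Finset.univ, Finset.card_univ, card_cube]
    norm_num
  have h2 : ∀ j : Fin 3, ∑ c : Fin 3 → Fin K, ∑ τ ∈ Finset.univ.filter (fun τ : Fin 3 → Fin 2 => τ j = 0),
          ‖wv (c + fun i : Fin 3 => ((τ i : ℕ) • (1 : Fin K)))
            - wv (c + (fun i : Fin 3 => ((τ i : ℕ) • (1 : Fin K))) + (Pi.single j (1 : Fin K) : Fin 3 → Fin K))‖ ^ 2 / 2
      ≤ 8 * ∑ B : Fin 3 → Fin K, ‖wv B‖ ^ 2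
          - ∑ c : Fin 3 → Fin K,
              ‖∑ τ : Fin 3 → Fin 2, wv (c + fun i : Fin 3 => ((τ i : ℕ) • (1 : Fin K)))‖ ^ 2 / 8 := by
    intro j
    rw [← h3, ← Finset.sum_sub_distrib]
    exact Finset.sum_le_sum fun c _ => superblock_cs wv c j
  have h4 : ∑ j : Fin 3, ∑ B : Fin 3 → Fin K, ‖wv B - wv (B + (Pi.single j (1 : Fin K) : Fin 3 → Fin K))‖ ^ 2 / 2
      ≤ ∑ j : Fin 3, (1 / 4 : ℝ) * (8 * ∑ B : Fin 3 → Fin K, ‖wv B‖ ^ 2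
          - ∑ c : Fin 3 → Fin K,
              ‖∑ τ : Fin 3 → Fin 2, wv (c + fun i : Fin 3 => ((τ i : ℕ) • (1 : Fin K)))‖ ^ 2 / 8) := by
    refine Finset.sum_le_sum fun j _ => ?_
    rw [h1 j]
    exact mul_le_mul_of_nonneg_left (h2 j) (by norm_num)
  rw [Finset.sum_const, Finset.card_univ, Fintype.card_fin] at h4
  simp only [nsmul_eq_mul, Nat.cast_ofNat] at h4
  linarith

/-- The axis successor `B ↦ B + e_j` on `(Fin K)³` has the successor SPEC used by the f-sum identity. -/
theorem succ_spec (j : Fin 3) (B : Fin 3 → Fin K) :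
    (∀ i : Fin 3, i ≠ j → (B + (Pi.single j (1 : Fin K) : Fin 3 → Fin K)) i = B i)
      ∧ (((B + (Pi.single j (1 : Fin K) : Fin 3 → Fin K)) j : ℕ) = ((B j : ℕ) + 1) % K) := by
  refine ⟨fun i hij => by rw [Pi.add_apply, Pi.single_eq_of_ne hij, add_zero], ?_⟩
  rw [Pi.add_apply, Pi.single_eq_same, Fin.val_add, Fin.val_one', Nat.add_mod_mod]

end Summit.AtomisticToContinuum.BoseEinsteinCondensation.Theses.BlockLatticeFSum.Superblock
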